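import Summits.CriticalPhenomena.PercolationContinuityZ3.Theorems.PercNearOneGluingNoHeavyLowerTailMajorityGluingTypeTableScaledDefs
import Summits.CriticalPhenomena.PercolationContinuityZ3.Theorems.PercNearOneGluingNoHeavyLowerTailMajorityGluingTypeTableFixedMIso
import HarnessLib

/-!
# Template S in the kernel: soundness of the cone certificate and the removal of the box rows
(lane prim-rate, constants-miner 1, gen 30; KERNEL-WINDOW.md §0 (5)(i); RIGOROUS-CERTIFICATION.md §1 «VALID U_j», bound programmes)

Support file for the closed crux `NoHeavyLowerTail` (stmt-CriticalPhenomena-4575), majority-gluing line; continuation of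
`…TypeTableScaledDefs` (`checkCone`, `checkS`, `SCert`) and `…TypeTableLPCert` (`resid`, `dualValue`, weak duality `linQ_le_resid`).
Two purely LP-level facts about a nonnegative vector `x̂` supported on `vs`:

* `cone_sound` — if `checkCone vs c rows y V = true` (exact dual feasibility on the support) and every row holds for `x̂`,
  then `lin c x̂ ≤ V`; no variable bounds are needed (the scaled variables have none);
* `checkS_objective_le` — THE STAR-SHAPED ARGUMENT: the certificate's rows other than the box rows hold for `x̂` and have
  nonnegative right-hand sides, the objective is `c = c₀ + E1·1_P` with `c₀ ≥ 0`, and `V < E1·BOX`.  If `Σ_P x̂ ≤ BOX` the box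
  rows hold and `lin c₀ x̂ ≤ V`; otherwise the rescaled vector `(BOX/Σ_P x̂)·x̂` satisfies every row (right-hand sides `≥ 0`)
  and all box rows, so `E1·BOX ≤ V` — impossible.  Hence **`lin c₀ x̂ ≤ V` for every `x̂ ≥ 0` supported on `vs` whose
  non-box rows hold**, where `c₀ = Σ_k g_k·fac_k` is the objective's factor part.

No percolation, no sorries.  [cite: VandenbergHaggstromKahn2005, Thm. 1.3 (p. 6)]
-/

namespace Summit.CriticalPhenomena.PercolationContinuityZ3.Theorems

namespace HubOnly
namespace TypeTable

open DType

noncomputable section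

/-! ### Elementary facts about `lin` -/

/-- A functional nonnegative on the table has nonnegative mass under a nonnegative law. -/
theorem lin_nonneg {φ : DType → ℤ} {x : DType → ℝ} (h : ∀ τ ∈ allTypes, 0 ≤ φ τ) (hx : ∀ τ, 0 ≤ x τ) : 0 ≤ lin φ x := by
  have := lin_mono (φ := fun _ => 0) (ψ := φ) h hx
  rwa [lin_eq_zero (fun _ _ => rfl)] at this

/-- Scaling a law scales every mass: `lin φ (t·x) = t·lin φ x`. -/
theorem lin_smul (φ : DType → ℤ) (t : ℝ) (x : DType → ℝ) : lin φ (fun τ => t * x τ) = t * lin φ x := by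
  unfold lin
  have : ∀ l : List DType, (l.map fun τ => (φ τ : ℝ) * (t * x τ)).sum = t * (l.map fun τ => (φ τ : ℝ) * x τ).sum := by
    intro l; induction l with
    | nil => simp
    | cons τ l ih => simp only [List.map_cons, List.sum_cons, ih]; ring
  exact this allTypes

/-- A rational functional that is `≤ 0` on the support of a nonnegative law has nonpositive mass. -/
private theorem sum_nonpos_supp (l : List DType) (ψ : DType → ℚ) (vs : DType → Bool) (x : DType → ℝ) (hx : ∀ τ, 0 ≤ x τ)
    (hsupp : ∀ τ, vs τ = false → x τ = 0) (hψ : ∀ τ ∈ l, vs τ = true → ψ τ ≤ 0) :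
    (l.map fun τ => (ψ τ : ℝ) * x τ).sum ≤ 0 := by
  induction l with
  | nil => simp
  | cons τ l ih =>
    simp only [List.map_cons, List.sum_cons]
    have hih := ih (fun σ hσ => hψ σ (List.mem_cons_of_mem _ hσ))
    have hτ : (ψ τ : ℝ) * x τ ≤ 0 := by
      cases h : vs τ
      · rw [hsupp τ h]; simp
      · exact mul_nonpos_of_nonpos_of_nonneg (by exact_mod_cast hψ τ (by simp) h) (hx τ)
    linarith

/-- **SOUNDNESS OF THE CONE CERTIFICATE.**  If `checkCone vs c rows y V = true` then every nonnegative `x̂` supported on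
`vs` that satisfies all rows has `lin c x̂ ≤ V`. -/
theorem cone_sound {vs : DType → Bool} {c : DType → ℤ} {rows : List Row} {y : List ℚ} {V : ℚ}
    (hcert : checkCone vs c rows y V = true) (x : DType → ℝ) (hx : ∀ τ, 0 ≤ x τ)
    (hsupp : ∀ τ, vs τ = false → x τ = 0) (hrows : ∀ r ∈ rows, lin r.φ x ≤ (r.b : ℝ)) :
    lin c x ≤ (V : ℝ) := by
  unfold checkCone at hcert
  simp only [Bool.and_eq_true, decide_eq_true_eq, List.all_eq_true, Bool.or_eq_true, Bool.not_eq_true'] at hcert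
  obtain ⟨⟨⟨hlen, hy⟩, hres⟩, hV⟩ := hcert
  have hdual := linQ_le_resid x rows y (fun σ => (c σ : ℚ)) hlen hy hrows
  have hsl : linQ (resid (fun σ => (c σ : ℚ)) rows y) x ≤ 0 :=
    sum_nonpos_supp allTypes _ vs x hx hsupp (fun τ hτ hv => by
      rcases hres τ hτ with h | h
      · rw [hv] at h; exact absurd h (by decide)
      · exact h)
  rw [linQ_intCast] at hdual
  have hV' : ((dualValue rows y : ℚ) : ℝ) ≤ (V : ℝ) := by exact_mod_cast hV
  linarith

/-! ### Right-hand sides of the non-box rows are nonnegative -/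

/-- `powUp lo hi m > 0` for positive brackets. -/
theorem powUp_pos {lo hi : ℚ} (hlo : 0 < lo) (hhi : 0 < hi) (m : ℤ) : 0 < powUp lo hi m := by
  unfold powUp; split
  · exact pow_pos hhi _
  · exact inv_pos.mpr (pow_pos hlo _)

/-- The grid constants of the five power-row kinds are positive. -/
theorem PKind.Cu_pos (k : ℕ) (κ : PKind) : 0 < κ.Cu k := by
  have e1 : (0 : ℚ) < ETAL := by decide +kernel
  have e2 : (0 : ℚ) < ETAU := by decide +kernel
  have t3 : (0 : ℚ) < TH3L := by decide +kernel
  have t3' : (0 : ℚ) < TH3U := by decide +kernel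
  have t4 : (0 : ℚ) < TH4L := by decide +kernel
  have t4' : (0 : ℚ) < TH4U := by decide +kernel
  cases κ <;> simp only [PKind.Cu] <;>
    first
    | exact mul_pos (mul_pos (powUp_pos t3 t3' _) (powUp_pos e1 e2 _)) (pow_pos t3' _)
    | exact mul_pos (mul_pos (powUp_pos t4 t4' _) (powUp_pos e1 e2 _)) (pow_pos t4' _)
    | exact mul_pos (powUp_pos t3 t3' _) (powUp_pos e1 e2 _)
    | exact mul_pos (powUp_pos t4 t4' _) (powUp_pos e1 e2 _)
    | exact powUp_pos e1 e2 _

/-- The support powers `Pu` are positive. -/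
theorem PKind.Pu_pos (κ : PKind) (m : ℤ) : 0 < κ.Pu m := by
  cases κ <;> simp only [PKind.Pu] <;> exact powUp_pos (by decide +kernel) (by decide +kernel) _

/-- A checked tangent row has a positive right-hand side. -/
theorem TRow.H_pos_of_ok {k : ℕ} {r : TRow} (h : r.ok k = true) : 0 < r.H := by
  obtain ⟨κ, i, j, N, G1, G2, H⟩ := r
  simp only [TRow.ok, Bool.and_eq_true, decide_eq_true_eq] at h
  obtain ⟨⟨⟨⟨_, hN⟩, c1⟩, _⟩, _⟩ := h
  have hq : 0 < 1 - 2 * κ.QL := by cases κ <;> simp only [PKind.QL, QL3, QL4] <;> norm_num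
  have hpos : 0 < κ.Cu k * κ.Pu (i + j) * (1 - 2 * κ.QL) := mul_pos (mul_pos (PKind.Cu_pos k κ) (PKind.Pu_pos κ _)) hq
  have hN' : (0 : ℚ) < N := by exact_mod_cast hN
  exact (div_pos_iff_of_pos_right hN').mp (lt_of_lt_of_le hpos c1)

/-- `CuS K t > 0`. -/
theorem CuS_pos (K t : ℕ) : 0 < CuS K t :=
  mul_pos (mul_pos (powUp_pos (by decide +kernel) (by decide +kernel) _) (powUp_pos (by decide +kernel) (by decide +kernel) _))
    (powUp_pos (by decide +kernel) (by decide +kernel) _)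

/-- The entries of `CBU240` are positive. -/
theorem CBU240_pos {h : ℚ} {t : ℕ} {cb : ℚ} (hcb : CBU240 h t = some cb) : 0 < cb := by
  unfold CBU240 at hcb; split_ifs at hcb <;> simp only [Option.some.injEq] at hcb <;> rw [← hcb] <;> norm_num

/-- **Every checked non-box row has a nonnegative right-hand side** (so the row set is star-shaped about `0`). -/
theorem SRow.b_nonneg_of_ok {K : ℕ} {cs : SCase} {restricted : Bool} :
    ∀ (r : SRow), r.ok K cs restricted = true → (∀ n B, r ≠ .box n B) → 0 ≤ (r.toRow cs).b
  | .lin _, _, _ => le_rfl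
  | .erow, _, _ => le_rfl
  | .dom _, _, _ => le_rfl
  | .bandhi z, _, _ => by simp only [SRow.toRow]; split <;> exact le_rfl
  | .bandlo _, _, _ => le_rfl
  | .junkE _, _, _ => le_rfl
  | .junk0 _, _, _ => le_rfl
  | .ctrlE _, _, _ => le_rfl
  | .ctrl0 _, _, _ => le_rfl
  | .relay z y, _, _ => by simp only [SRow.toRow]; split <;> exact le_rfl
  | .tan r, h, _ => by
    simp only [SRow.ok, Bool.and_eq_true] at h
    simp only [SRow.toRow, TRow.toRow]
    exact (TRow.H_pos_of_ok h.1).le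
  | .star z t i N G H, h, _ => by
    simp only [SRow.ok, Bool.and_eq_true, decide_eq_true_eq, Bool.not_eq_true'] at h
    obtain ⟨⟨⟨_, hN⟩, c1⟩, _⟩ := h
    simp only [SRow.toRow]
    have hq : (0 : ℚ) < 1 - 2 * QL4 := by simp only [QL4]; norm_num
    have hpos : 0 < CuS K t * powUp TH4L TH4U (2 * i) * (1 - 2 * QL4) :=
      mul_pos (mul_pos (CuS_pos K t) (powUp_pos (by decide +kernel) (by decide +kernel) _)) hq
    have hN' : (0 : ℚ) < N := by exact_mod_cast hN
    have := (div_pos_iff_of_pos_right hN').mp (lt_of_lt_of_le hpos c1)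
    exact this.le
  | .starB z t i N G H, h, _ => by
    simp only [SRow.ok, Bool.and_eq_true, decide_eq_true_eq, Bool.not_eq_true', Bool.or_eq_true] at h
    obtain ⟨⟨_, hN⟩, hc⟩ := h
    simp only [SRow.toRow]
    cases hb : (cs.bandOf cs.w).hi with
    | none => simp [hb] at hc
    | some hw =>
      simp only [hb] at hc
      cases hcb : CBU240 hw t with
      | none => simp [hcb] at hc
      | some cb =>
        simp only [hcb, Bool.and_eq_true, decide_eq_true_eq] at hc
        obtain ⟨c1, _⟩ := hc
        have hq : (0 : ℚ) < 1 - EBL := by simp only [EBL]; norm_num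
        have hpos : 0 < cb * powUp ZL ZU i * (1 - EBL) :=
          mul_pos (mul_pos (CBU240_pos hcb) (powUp_pos (by decide +kernel) (by decide +kernel) _)) hq
        have hN' : (0 : ℚ) < N := by exact_mod_cast hN
        exact ((div_pos_iff_of_pos_right hN').mp (lt_of_lt_of_le hpos c1)).le
  | .box n B, _, hne => absurd rfl (hne n B)

/-! ### The star-shaped argument: removing the box rows -/

/-- The `P`-column sum `Σ_{τ ∈ P} x̂_τ`. -/
abbrev Psum (restricted : Bool) (w : ℕ) (x : DType → ℝ) : ℝ := lin (fun τ => ind (pcol restricted w τ)) x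

/-- The factor part `c₀ = Σ_k g_k·fac_k` of the objective, as the real number `Σ_k g_k·lin(fac_k)(x̂)`. -/
def objFac (cs : SCase) (W : SWorld) (o : SObj) (x : DType → ℝ) : ℝ :=
  (((W.zs cs).zip o.gs).map fun p => (p.2 : ℝ) * lin (W.facφ p.1) x).sum

/-- The objective functional integrates to `objFac + E1·Psum`. -/
theorem lin_objφ (cs : SCase) (W : SWorld) (o : SObj) (x : DType → ℝ) :
    lin (o.φ cs W) x = objFac cs W o x + (o.E1 : ℝ) * Psum W.restricted cs.w x := by
  unfold SObj.φ objFac Psum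
  -- peel the zipped list
  have key : ∀ (L : List (ℕ × ℕ)),
      lin (fun τ => ((L.map fun p => (p.2 : ℤ) * W.facφ p.1 τ).sum + (if pcol W.restricted cs.w τ then (o.E1 : ℤ) else 0))) x
        = (L.map fun p => (p.2 : ℝ) * lin (W.facφ p.1) x).sum + (o.E1 : ℝ) * lin (fun τ => ind (pcol W.restricted cs.w τ)) x := by
    intro L
    induction L with
    | nil =>
      simp only [List.map_nil, List.sum_nil, zero_add]
      have h := lin_combo [((o.E1 : ℤ), fun τ => ind (pcol W.restricted cs.w τ))] x
      simp only [List.map_cons, List.map_nil, List.sum_cons, List.sum_nil, add_zero] at h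
      push_cast at h
      rw [← h]
      exact lin_congr (fun τ _ => by simp only [combo, List.map_cons, List.map_nil, List.sum_cons, List.sum_nil, add_zero, ind]; split <;> simp) x
    | cons p L ih =>
      simp only [List.map_cons, List.sum_cons]
      have h := lin_combo [((p.2 : ℤ), W.facφ p.1), (1, fun τ => (L.map fun p => (p.2 : ℤ) * W.facφ p.1 τ).sum +
        (if pcol W.restricted cs.w τ then (o.E1 : ℤ) else 0))] x
      simp only [List.map_cons, List.map_nil, List.sum_cons, List.sum_nil, add_zero, Int.cast_one, one_mul] at h
      rw [ih] at h
      have e : lin (fun τ => (p.2 : ℤ) * W.facφ p.1 τ + (L.map fun p => (p.2 : ℤ) * W.facφ p.1 τ).sum +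
          (if pcol W.restricted cs.w τ then (o.E1 : ℤ) else 0)) x =
          lin (combo [((p.2 : ℤ), W.facφ p.1), (1, fun τ => (L.map fun p => (p.2 : ℤ) * W.facφ p.1 τ).sum +
            (if pcol W.restricted cs.w τ then (o.E1 : ℤ) else 0))]) x :=
        lin_congr (fun τ _ => by
          simp only [combo, List.map_cons, List.map_nil, List.sum_cons, List.sum_nil, add_zero, one_mul]; ring) x
      rw [e, h]; push_cast; ring
  exact key _

/-- The factor functionals are indicator-like (`≥ 0` on the table), so `objFac ≥ 0` under a nonnegative law. -/
theorem objFac_nonneg (cs : SCase) (W : SWorld) (o : SObj) {x : DType → ℝ} (hx : ∀ τ, 0 ≤ x τ) : 0 ≤ objFac cs W o x := by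
  unfold objFac
  have : ∀ (L : List (ℕ × ℕ)), 0 ≤ (L.map fun p => (p.2 : ℝ) * lin (W.facφ p.1) x).sum := by
    intro L; induction L with
    | nil => simp
    | cons p L ih =>
      simp only [List.map_cons, List.sum_cons]
      have h0 : 0 ≤ lin (W.facφ p.1) x := lin_nonneg (fun τ _ => by
        cases W <;> simp only [SWorld.facφ, stφ, ind] <;> split_ifs <;> simp) hx
      have : 0 ≤ (p.2 : ℝ) * lin (W.facφ p.1) x := mul_nonneg (Nat.cast_nonneg _) h0
      linarith
  exact this _

/-- A box row's mass is at most the `P`-column sum (its type is a `P`-column). -/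
theorem box_le_Psum {K : ℕ} {cs : SCase} {restricted : Bool} {n : ℕ} {B : ℚ} (hok : SRow.ok K cs restricted (.box n B) = true)
    {x : DType → ℝ} (hx : ∀ τ, 0 ≤ x τ) : lin ((SRow.box n B).toRow cs).φ x ≤ Psum restricted cs.w x := by
  simp only [SRow.ok, Bool.and_eq_true, decide_eq_true_eq] at hok
  obtain ⟨_, hp⟩ := hok
  simp only [SRow.toRow]
  refine lin_mono (fun τ _ => ?_) hx
  by_cases h : τ = typeAt n
  · subst h; simp [hp, ind]
  · simp [h, ind]; split <;> simp

/-- Scaling preserves the support and nonnegativity, and every row with `b ≥ 0` (for `0 ≤ t ≤ 1`). -/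
theorem row_smul {φ : DType → ℤ} {b : ℚ} {x : DType → ℝ} {t : ℝ} (ht0 : 0 ≤ t) (ht1 : t ≤ 1) (hb : 0 ≤ b)
    (h : lin φ x ≤ (b : ℝ)) : lin φ (fun τ => t * x τ) ≤ (b : ℝ) := by
  rw [lin_smul]
  have hb' : (0 : ℝ) ≤ b := by exact_mod_cast hb
  nlinarith

/-- Box rows are exactly the rows of the form `.box n B`. -/
def SRow.isBox : SRow → Bool
  | .box _ _ => true
  | _ => false

/-- **THE OBJECTIVE BOUND WITHOUT THE BOX** (star-shaped argument).  If `checkS K cs W c = true`, then for every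
nonnegative `x̂` supported on the world's support whose NON-box rows hold, the factor part of the objective satisfies
`objFac cs W c.obj x̂ ≤ V` (and the `P`-column sum is `≤ BOX`). -/
theorem checkS_objective_le {K : ℕ} {cs : SCase} {W : SWorld} {c : SCert} (h : checkS K cs W c = true)
    (x : DType → ℝ) (hx : ∀ τ, 0 ≤ x τ) (hsupp : ∀ τ, vset W.restricted cs.w τ = false → x τ = 0)
    (hrows : ∀ r ∈ c.rows, r.isBox = false → lin (r.toRow cs).φ x ≤ ((r.toRow cs).b : ℝ)) :
    objFac cs W c.obj x ≤ (c.V : ℝ) := by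
  unfold checkS at h
  simp only [Bool.and_eq_true, decide_eq_true_eq, List.all_eq_true] at h
  obtain ⟨⟨⟨⟨⟨⟨⟨_, hok⟩, _⟩, hboxIs⟩, hBOX⟩, hV0⟩, hVE⟩, hcone⟩ := h
  set s := Psum W.restricted cs.w x with hs
  have hs0 : 0 ≤ s := lin_ind_nonneg _ hx
  have hfac0 := objFac_nonneg cs W c.obj hx
  -- rows hold for a scaled vector `t·x` with `0 < t ≤ 1` and `t·s ≤ BOX`
  have allrows : ∀ (t : ℝ), 0 ≤ t → t ≤ 1 → t * s ≤ (c.BOX : ℝ) →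
      ∀ r ∈ c.rows.map (SRow.toRow cs), lin r.φ (fun τ => t * x τ) ≤ (r.b : ℝ) := by
    intro t ht0 ht1 hts r hr
    obtain ⟨sr, hsr, rfl⟩ := List.mem_map.mp hr
    have hk := hok sr hsr
    by_cases hb : sr.isBox = true
    · obtain ⟨n, B, hnb⟩ : ∃ n B, sr = .box n B := by
        cases sr <;> simp [SRow.isBox] at hb; exact ⟨_, _, rfl⟩
      subst hnb
      have hB : B = c.BOX := by have := hboxIs _ hsr; simpa [SRow.boxIs] using this
      have h1 := box_le_Psum (K := K) hk hx
      rw [lin_smul]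
      calc t * lin ((SRow.box n B).toRow cs).φ x ≤ t * s := mul_le_mul_of_nonneg_left h1 ht0
        _ ≤ c.BOX := hts
        _ = (((SRow.box n B).toRow cs).b : ℝ) := by simp [SRow.toRow, hB]
    · have hb' : sr.isBox = false := by simpa using hb
      have hne : ∀ n B, sr ≠ .box n B := by intro n B e; subst e; simp [SRow.isBox] at hb'
      exact row_smul ht0 ht1 (SRow.b_nonneg_of_ok sr hk hne) (hrows sr hsr hb')
  have supp_t : ∀ (t : ℝ) τ, vset W.restricted cs.w τ = false → (fun τ => t * x τ) τ = 0 := fun t τ hτ => by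
    simp [hsupp τ hτ]
  have nonneg_t : ∀ (t : ℝ), 0 ≤ t → ∀ τ, 0 ≤ (fun τ => t * x τ) τ := fun t ht τ => mul_nonneg ht (hx τ)
  by_cases hsB : s ≤ c.BOX
  · -- the box rows hold for `x` itself (`t = 1`)
    have h1 := cone_sound hcone (fun τ => 1 * x τ) (nonneg_t 1 zero_le_one) (supp_t 1)
      (allrows 1 zero_le_one le_rfl (by linarith))
    have e : (fun τ => (1 : ℝ) * x τ) = x := funext fun τ => one_mul _
    rw [e, lin_objφ] at h1
    have hE : (0 : ℝ) ≤ (c.obj.E1 : ℝ) * s := mul_nonneg (Nat.cast_nonneg _) hs0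
    linarith
  · -- rescale by `t = BOX/s < 1`: every row and box row holds, so `E1·BOX ≤ V` — contradiction
    push Not at hsB
    have hspos : 0 < s := lt_trans (by exact_mod_cast hBOX) hsB
    set t : ℝ := (c.BOX : ℝ) / s with ht
    have ht0 : 0 ≤ t := div_nonneg (by exact_mod_cast hBOX.le) hs0
    have ht1 : t ≤ 1 := (div_le_one hspos).mpr hsB.le
    have hts : t * s = c.BOX := div_mul_cancel₀ _ (ne_of_gt hspos)
    have h1 := cone_sound hcone (fun τ => t * x τ) (nonneg_t t ht0) (supp_t t) (allrows t ht0 ht1 hts.le)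
    rw [lin_objφ] at h1
    have hf0 := objFac_nonneg cs W c.obj (nonneg_t t ht0)
    have hP : Psum W.restricted cs.w (fun τ => t * x τ) = t * s := by simp only [Psum, hs]; exact lin_smul _ t x
    rw [hP, hts] at h1
    have hVE' : (c.V : ℝ) < (c.obj.E1 : ℝ) * (c.BOX : ℝ) := by exact_mod_cast hVE
    linarith

end

end TypeTable
end HubOnly

end Summit.CriticalPhenomena.PercolationContinuityZ3.Theorems
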